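import Summits.BirchSwinnertonDyer.BirchSwinnertonDyer.Theses.ShadowIsolation
import Summits.BirchSwinnertonDyer.BirchSwinnertonDyer.Theorems.ShadowIsolationIsolationOfAccidentalZerosStubDepthRigidity
import Summits.BirchSwinnertonDyer.BirchSwinnertonDyer.Theorems.ShadowIsolationIsolationOfAccidentalZerosStubRationalSectorFinite
import Summits.BirchSwinnertonDyer.BirchSwinnertonDyer.Theorems.ShadowIsolationIsolationOfAccidentalZerosStubTransfer
import Literature.NumberTheory.EllipticCurves.CuspFormLFunction
import Literature.NumberTheory.EllipticCurves.EichlerShimuraConstruction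
import Literature.NumberTheory.EllipticCurves.DeepCongruenceFiniteness

/-!
# Line `birth` (BC3 skeleton) for crux `ShadowIsolation.IsolationOfAccidentalZeros`
# (stmt-BirchSwinnertonDyer-15786, route `route-BirchSwinnertonDyer-ShadowIsolation`, crux rank 2)

Registered by the skeleton registrar `planner-skel-stmt-BirchSwinnertonDyer-15786-0` (2026-08-17).

**v2 (lead `prover-line-stmt-BirchSwinnertonDyer-15786-0`, 2026-08-17, cycle 1).** Reshape of K: the only
input of K that is NOT proved in the tree is the Modularity Theorem (`exists_isNewformOf`, BCDT 2001 Thm A,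
named fact of `Literature.NumberTheory.EllipticCurves.CuspFormLFunction`); strong multiplicity one across
levels / at one level, `T_p f = a_p f` and Shimura integrality are PROVED
(`IsNewform0.level_eq_of_heckeEigenvalue_eq_holds`, `IsNewform0.eq_of_heckeEigenvalue_eq_holds`,
`IsNewform0.heckeEigenvalue_eq_coeff_holds`, `IsNewform0.isIntegral_coeff_holds`). So modularity becomes
its own registered stub `stub_modularity` (X-sized named fact; the skeleton is CLOSED MODULO it and it is
never briefed to a worker) and `stub_depthRigidity` takes it as its first hypothesis.

**v3 (lead `prover-line-stmt-BirchSwinnertonDyer-15786-c1-0`, 2026-08-17, cycle 1, continuation).** Reshape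
of F_rat along its two published inputs, exactly as v2 did for K:
* the rational / irrational split of the shadow set is now by "every `q`-expansion coefficient of `g` is a
  rational integer" (for a newform this is the same sector as "all `a_ℓ(g) ∈ ℤ`, `ℓ ∤ N_W·M`", but it is the
  hypothesis the Eichler–Shimura fact of the tree consumes verbatim);
* `stub_eichlerShimura : eichlerShimuraConstruction` — the tree's named fact (Knapp Thm 11.74 + Carayol,
  `Literature.NumberTheory.EllipticCurves.EichlerShimuraConstruction`; reduced in tree to modularity + the
  Eichler–Shimura congruence relation, `eichlerShimuraConstruction_holds_of`), X-sized, never briefed;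
* `stub_deepCongruenceFinite : DeepCongruenceFinite` — NEW named fact stated below (Mordell–Faltings on the
  twisted modular curves `X_E^α(p^n)`, genus `≥ 2` for `p^n ≥ 7`, with Carayol's trace theorem): for fixed
  `E/ℚ` and `p` odd with `E[p]` irreducible, only finitely many `L`-coefficient systems of elliptic curves
  `E'/ℚ` are congruent to that of `E` modulo `p^n` at almost all primes; X-sized, never briefed; to be filed
  under `Literature/NumberTheory/EllipticCurves/` by the worker of F_rat (inline-fact relocation);
* `stub_rationalSectorFinite` takes both as hypotheses and is then bookkeeping over PROVED tree theorems
  (`heckeEigenvalue_eq_coeff_holds`, `level_eq_of_heckeEigenvalue_eq_holds`, the `q`-expansion principle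
  `eq_of_forall_cuspCoeff_eq_gamma0`, `LFunction_apply_prime_eq_frobeniusTrace`).
The composition `IsolationOfAccidentalZeros_of` is unchanged in shape (6 stub statements → crux BY NAME).

**v4 (lead `prover-line-stmt-BirchSwinnertonDyer-15786-c2-0`, 2026-08-17, cycle 1, continuation).** Wave 1
LANDED the two theorem-level stubs and the new named fact, so three of the six `stub_*` are now sorry-free
references to accepted tree declarations:
* K · `stub_depthRigidity` := `Summit.BirchSwinnertonDyer.BirchSwinnertonDyer.Theorems.stub_depthRigidity`
  (p145424, `Theorems/ShadowIsolationIsolationOfAccidentalZerosStubDepthRigidity.lean`, 0 sorries, axioms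
  propext/Classical.choice/Quot.sound): minimal-polynomial depth bound + strong multiplicity one across
  variable levels, given modularity;
* DC · the named fact `DeepCongruenceFinite` is now the ACCEPTED Literature definition
  `Literature.NumberTheory.EllipticCurves.DeepCongruenceFinite` (p146640,
  `Literature/NumberTheory/EllipticCurves/DeepCongruenceFiniteness.lean`); the inline copy is gone from this
  file and `stub_deepCongruenceFinite : DeepCongruenceFinite` refers to the tree fact (still an X-stub: the
  fact itself — Faltings 1983 Satz 7 + Carayol — is not discharged);
* F_rat · `stub_rationalSectorFinite` :=
  `Summit.BirchSwinnertonDyer.BirchSwinnertonDyer.Theorems.stub_rationalSectorFinite` (p148213,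
  `Theorems/ShadowIsolationIsolationOfAccidentalZerosStubRationalSectorFinite.lean`, 0 sorries): depth
  `n = 2`, Eichler–Shimura curve `E_g`, membership of `(aₘ(E_g))ₘ` in the finite set of `DeepCongruenceFinite`,
  injectivity of `(M, g) ↦ (aₘ(g))ₘ` by strong multiplicity one + the `q`-expansion principle.
Remaining sorries: the three X-facts `stub_modularity` (BCDT), `stub_eichlerShimura` (Knapp 11.74 + Carayol),
`stub_deepCongruenceFinite` (Faltings + Carayol) — named Literature facts, never briefed — and the open core
`stub_irrationalShadowsFinite` (crux-equivalent on the irrational sector given K and F_rat).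

**v5 (same lead, cycle 1).** The composition itself becomes the registered transfer stub `stub_transfer`
(T : M → ES → DC → F_irr → crux), so that the reduction "crux ⇐ three named facts + F_irr" lands as a TREE
theorem (`Theorems/ShadowIsolationIsolationOfAccidentalZerosStubTransfer.lean`, also exporting the alias
`isolationOfAccidentalZeros_of_irrationalShadowsFinite`); `IsolationOfAccidentalZeros_of` is now the one-liner
`T M ES DC F_irr`, and the shadow-set machinery (`A_n`, `A_{n+1} ⊆ A_n`, the finite-supremum argument) lives
in the proof of T.

**v6 (same lead, cycle 1).** T LANDED: `stub_transfer := Summit.BirchSwinnertonDyer.BirchSwinnertonDyer.Theorems.stub_transfer`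
(p150301, `Theorems/ShadowIsolationIsolationOfAccidentalZerosStubTransfer.lean`, axioms propext/Classical.choice/Quot.sound).
Remaining sorries = exactly the three named Literature facts (modularity BCDT, Eichler–Shimura, DeepCongruenceFinite) and
the open core F_irr; the crux is thereby a tree-certified consequence of {3 named facts, F_irr}. In this file
`IsolationOfAccidentalZeros_of` now calls the tree theorem T directly on the four open stub statements (the in-file
restatement of T is dropped: a proved theorem concluding the crux ahead of the composition confuses the skeleton check).

## The crux (recall)

`IsolationOfAccidentalZeros`: for `W/ℚ` globally minimal elliptic and `p ≥ 5` good ordinary with `E[p]`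
irreducible there is a depth `n₀` such that for `n ≥ n₀` there is NO *depth-`n` shadow*: a pair `(M, g)`,
`M` squarefree and coprime to `p·N_W`, `g ∈ S₂(Γ₀(N_W·M))` a newform (`IsNewform0`) whose `q`-expansion is
not `(aₘ(W))ₘ`, with Fricke eigenvalue `−1` (sign `+1`), whose Hecke eigenvalues `a_ℓ(g)`, `ℓ ∤ N_W·M`, map
to `a_ℓ(W)` under a ring homomorphism `φ : R → ℤ/pⁿ` (`R ⊆ ℂ` a subring containing them), and whose
`L`-series has an entire continuation vanishing at `s = 1`.

## The line: isolation = depth rigidity + finiteness at ONE depth (compactness cut)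

Write `A_n(W,p) ⊆ Σ M, S₂(Γ₀(N_W·M))` for the set of depth-`n` shadows. Two formal facts drive the cut:
`A_{n+1} ⊆ A_n` (reduce `φ` modulo `pⁿ`), and the crux is `A_n = ∅` for `n ≫ 0`. Hence the crux follows — by
a finite-supremum (König-type) argument, the transfer stub T (`stub_transfer`, proved sorry-free in
`Theorems/ShadowIsolationIsolationOfAccidentalZerosStubTransfer.lean`) — from

* **K · `stub_depthRigidity`** (THEOREM in print; provable now modulo modularity): a FIXED newform `g` of
  level `N_W·M` whose `q`-expansion differs from `(aₘ(W))ₘ` is congruent to `W` only to bounded `p`-adic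
  depth. Print proof: by modularity (`exists_isNewformOf`) and strong multiplicity one across levels
  (`IsNewform0.level_eq_of_heckeEigenvalue_eq_holds` / `eq_of_heckeEigenvalue_eq_holds`, with
  `heckeEigenvalue_eq_coeff_holds`) some prime `ℓ₀ ∤ N_W·M` has `x := a_{ℓ₀}(g) − a_{ℓ₀}(W) ≠ 0`; `x` is an
  algebraic integer (`IsNewform0.isIntegral_coeff_holds`) with minimal polynomial `m_x ∈ ℤ[X]`,
  `m_x(0) ≠ 0`, and `φ(x) = 0` forces `pⁿ ∣ m_x(0)`; so `n ≤ v_p(m_x(0))`.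
* **F_rat · `stub_rationalSectorFinite`** (THEOREM in print; bookkeeping modulo the two X-facts
  `stub_eichlerShimura`, `stub_deepCongruenceFinite`): at depth `n = 2` (`p² ≥ 25 ≥ 7`) only finitely many
  pairs `(M, g)` — `g` a newform of level `N_W·M` with INTEGER `q`-expansion — are depth-`2` congruent to
  `W`. Proof: `g ↦ E_g` (`eichlerShimuraConstruction`: `IsNewformOf E_g g`, so `aₘ(g) = aₘ(E_g)`); the
  congruence `φ(a_ℓ(g)) = a_ℓ(W)` at `ℓ ∤ N_W·M` reads `p² ∣ a_ℓ(E_g) − a_ℓ(W)` in `ℤ`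
  (`heckeEigenvalue_eq_coeff_holds`, `LFunction_apply_prime_eq_frobeniusTrace`, `map_intCast`); so
  `(aₘ(E_g))ₘ` lies in the finite set of `DeepCongruenceFinite`; and `(M, g) ↦ (aₘ(g))ₘ` is injective
  (`level_eq_of_heckeEigenvalue_eq_holds` gives `M = M'`, the `q`-expansion principle gives `g = g'`).
* **F_irr · `stub_irrationalShadowsFinite`** (the OPEN core; research-sized): at SOME depth `n` the
  depth-`n` shadows `(M, g)` whose `q`-expansion is NOT integral form a finite set. This is where the even
  sign and `Λ(g,1) = 0` bite: without them the set is infinite at every depth by level raising at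
  `n`-admissible primes (Diamond–Taylor 1994, Bertolini–Darmon 2005). NOTE (lead, v3): given K and F_rat
  this stub is EQUIVALENT to the crux restricted to the irrational sector (crux ⇒ `A_{n₀} = ∅` is finite;
  conversely by `IsolationOfAccidentalZeros_of`), so it is exactly crux-sized, not a weakening.

Disproof.lean: none exists for this crux yet (no `_false_without_` obstructions to honour).
-/

set_option linter.unusedVariables false
set_option linter.dupNamespace false

noncomputable section

namespace Summit.BirchSwinnertonDyer.BirchSwinnertonDyer.Cruxes.IsolationOfAccidentalZeros.Birth

open scoped MatrixGroups ModularForm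
open CongruenceSubgroup UpperHalfPlane
open Summit.BirchSwinnertonDyer.BirchSwinnertonDyer.Theses.ShadowIsolation
open Literature.NumberTheory.EllipticCurves Literature.NumberTheory.EllipticCurves.ModularForms

/-! ## The named fact consumed by F_rat

`DeepCongruenceFinite` (Mordell–Faltings on the twists `X_E^α(pⁿ)`, `pⁿ ≥ 7`, with Carayol 1994 Thm 1) is,
since v4, the accepted Literature definition `Literature.NumberTheory.EllipticCurves.DeepCongruenceFinite`
(`Literature/NumberTheory/EllipticCurves/DeepCongruenceFiniteness.lean`, p146640), imported above; the
short name resolves through `open Literature.NumberTheory.EllipticCurves`. -/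

/-! ## Registered stubs -/

/-- **M · `stub_modularity` — the Modularity Theorem, Version `L` (Wiles 1995, Taylor–Wiles 1995,
Breuil–Conrad–Diamond–Taylor 2001 Thm. A, with level = conductor, Carayol 1986): every elliptic `W/ℚ` has a
newform `f ∈ S₂(Γ₀(N_W))` with `aₙ(f) = aₙ(W)` for all `n`.** This is VERBATIM the named Literature fact
`Literature.NumberTheory.EllipticCurves.ModularForms.exists_isNewformOf` (`CuspFormLFunction.lean`), which is
NOT discharged in the tree. X-sized: never briefed to a stub-worker; the skeleton is closed MODULO this fact
and K consumes it as an explicit hypothesis. [cite: BreuilConradDiamondTaylor2001, Thm. A] -/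
theorem stub_modularity : exists_isNewformOf := by
  sorry

/-- **K · `stub_depthRigidity` — a fixed newform is congruent to `W` only to bounded `p`-adic depth,
GIVEN modularity (THEOREM in print: modularity BCDT 2001 + strong multiplicity one Atkin–Lehner 1970 Thm 4 +
integrality of Hecke eigenvalues Shimura 1971 Thm 3.48; see the module docstring).** Assuming
`exists_isNewformOf`: for `W/ℚ` globally minimal elliptic, `p` prime, `g ∈ S₂(Γ₀(N_W·M))` a newform whose
`q`-expansion is not `(aₘ(W))ₘ`, there is `n` such that no ring homomorphism `φ : R → ℤ/pⁿ` on a subring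
`R ⊆ ℂ` containing the `a_ℓ(g)`, `ℓ ∤ N_W·M`, sends every such `a_ℓ(g)` to `a_ℓ(W)`. Proof plan: either some
prime `ℓ₀ ∤ N_W·M` has `a_{ℓ₀}(g) ≠ a_{ℓ₀}(W)` — then `x = a_{ℓ₀}(g) − a_{ℓ₀}(W)` is a nonzero algebraic integer
(`IsNewform0.heckeEigenvalue_eq_coeff_holds`, `IsNewform0.isIntegral_coeff_holds`), root of a monic
`Q ∈ ℤ[X]` with `Q(0) ≠ 0`, and `φ(x) = 0` forces `pⁿ ∣ Q(0)`; or all `a_ℓ(g) = a_ℓ(W)` off `N_W·M` — then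
with the newform `f_W` of `W` (modularity; `a_ℓ(f_W) = a_ℓ(W)` by `LFunction_apply_prime_eq_frobeniusTrace`
and `dvd_conductorNorm_iff_not_hasGoodReductionAtPrime`) strong multiplicity one
(`IsNewform0.level_eq_of_heckeEigenvalue_eq_holds`, `eq_of_heckeEigenvalue_eq_holds`) gives `M = 1`,
`g = f_W`, contradicting the `q`-expansion mismatch. **LANDED (v4)**: this is now the accepted tree theorem
`Summit.BirchSwinnertonDyer.BirchSwinnertonDyer.Theorems.stub_depthRigidity` (p145424).
[cite: AtkinLehner1970, Thm. 4] [cite: Shimura1971, Thm. 3.48] [cite: BreuilConradDiamondTaylor2001, Thm. A] -/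
theorem stub_depthRigidity : exists_isNewformOf →
    ∀ (W : WeierstrassCurve ℚ) [W.IsElliptic] [W.IsGloballyMinimal] (p : ℕ) [Fact p.Prime]
      (M : ℕ) [NeZero (W.conductorNorm ℤ * M)]
      (g : CuspForm (CongruenceSubgroup.Gamma0 (W.conductorNorm ℤ * M)) 2),
      IsNewform0 g → (∃ m : ℕ, (qExpansion 1 ⇑g).coeff m ≠ ((W.LFunction m : ℤ) : ℂ)) →
      ∃ n : ℕ, ∀ (R : Subring ℂ) (φ : R →+* ZMod (p ^ n))
        (hR : ∀ ℓ : ℕ, ℓ.Prime → ¬ ℓ ∣ W.conductorNorm ℤ * M → heckeEigenvalue g ℓ ∈ R),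
        ¬ ∀ (ℓ : ℕ) (hℓ : ℓ.Prime) (hℓL : ¬ ℓ ∣ W.conductorNorm ℤ * M),
            φ ⟨heckeEigenvalue g ℓ, hR ℓ hℓ hℓL⟩ = ((W.frobeniusTrace ℓ : ℤ) : ZMod (p ^ n)) :=
  Summit.BirchSwinnertonDyer.BirchSwinnertonDyer.Theorems.stub_depthRigidity

/-- **ES · `stub_eichlerShimura` — the Eichler–Shimura construction with Carayol's theorem (Knapp 1993
Thm 11.74 + Thm 12.8; BCDT 2001 p. 845 "(2) ⇒ (6)").** VERBATIM the tree's named Literature fact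
`Literature.NumberTheory.EllipticCurves.ModularForms.eichlerShimuraConstruction`
(`EichlerShimuraConstruction.lean`; reduced in tree to modularity + the Eichler–Shimura congruence relation
by `eichlerShimuraConstruction_holds_of`, not discharged). X-sized: never briefed to a stub-worker; F_rat
consumes it as an explicit hypothesis. [cite: Knapp1993, Thm. 11.74 and Thm. 12.8] -/
theorem stub_eichlerShimura : eichlerShimuraConstruction := by
  sorry

/-- **DC · `stub_deepCongruenceFinite` — finiteness of deep congruences to a fixed elliptic curve
(Faltings 1983 on the twists `X_E^α(pⁿ)`, `pⁿ ≥ 7`, with Carayol 1994 Thm 1).** VERBATIM the named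
Literature fact `Literature.NumberTheory.EllipticCurves.DeepCongruenceFinite`
(`DeepCongruenceFiniteness.lean`, accepted p146640, not discharged). X-sized: never briefed to a
stub-worker; F_rat consumes it as an explicit hypothesis.
[cite: Faltings1983Endlichkeit, Satz 7] [cite: Mazur1989Deforming, §1.8 Prop. (Carayol)] -/
theorem stub_deepCongruenceFinite : DeepCongruenceFinite := by
  sorry

/-- **F_rat · `stub_rationalSectorFinite` — Mordell–Faltings finiteness of deep RATIONAL congruences,
GIVEN the Eichler–Shimura construction and `DeepCongruenceFinite` (bookkeeping over proved tree theorems;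
see the module docstring).** For `W/ℚ` globally minimal elliptic and `p ≥ 5` good ordinary with `E[p]`
irreducible there is a depth `n` (namely `n = 2`) at which only finitely many pairs `(M, g)` — `M`
squarefree coprime to `p·N_W`, `g` a newform of level `N_W·M` with integer `q`-expansion — are depth-`n`
congruent to `W`. **LANDED (v4)**: this is now the accepted tree theorem
`Summit.BirchSwinnertonDyer.BirchSwinnertonDyer.Theorems.stub_rationalSectorFinite` (p148213).
[cite: Faltings1983Endlichkeit, Satz 7] [cite: Knapp1993, Thm. 11.74 and Thm. 12.8] -/
theorem stub_rationalSectorFinite : eichlerShimuraConstruction → DeepCongruenceFinite →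
    ∀ (W : WeierstrassCurve ℚ) [W.IsElliptic] [W.IsGloballyMinimal] (p : ℕ) [Fact p.Prime],
      5 ≤ p → W.HasGoodReductionAtPrime p → ¬ (p : ℤ) ∣ W.frobeniusTrace p →
      W.HasIrreducibleModPGaloisRep p →
      ∃ n : ℕ, Set.Finite {x : Σ M : ℕ, CuspForm (CongruenceSubgroup.Gamma0 (W.conductorNorm ℤ * M)) 2 |
        ∃ (_ : NeZero (W.conductorNorm ℤ * x.1)) (R : Subring ℂ) (φ : R →+* ZMod (p ^ n)) (hR : ∀ ℓ : ℕ, ℓ.Prime → ¬ ℓ ∣ W.conductorNorm ℤ * x.1 → heckeEigenvalue x.2 ℓ ∈ R), (∀ m : ℕ, ∃ a : ℤ, (qExpansion 1 ⇑(x.2)).coeff m = (a : ℂ)) ∧ Squarefree x.1 ∧ Nat.Coprime x.1 (p * W.conductorNorm ℤ) ∧ IsNewform0 x.2 ∧ (∀ (ℓ : ℕ) (hℓ : ℓ.Prime) (hℓL : ¬ ℓ ∣ W.conductorNorm ℤ * x.1), φ ⟨heckeEigenvalue x.2 ℓ, hR ℓ hℓ hℓL⟩ = ((W.frobeniusTrace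 ℓ : ℤ) : ZMod (p ^ n)))} :=
  Summit.BirchSwinnertonDyer.BirchSwinnertonDyer.Theorems.stub_rationalSectorFinite

/-- **F_irr · `stub_irrationalShadowsFinite` — the OPEN core: finiteness of irrational shadows at ONE
depth.** For `W/ℚ` globally minimal elliptic and `p ≥ 5` good ordinary with `E[p]` irreducible there is a
depth `n` at which the depth-`n` shadows `(M, g)` (all clauses of the crux: squarefree coprime level
raising, newform, `q`-expansion `≠ (aₘ(W))ₘ`, Fricke eigenvalue `−1`, depth-`n` congruence, entire
continuation of `L(g,s)` vanishing at `s = 1`) whose `q`-expansion is NOT integral form a finite set.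
Why it might fail: it is a non-vanishing statement for even-sign newforms in the squarefree-level aspect at
fixed `f_W` (the crux's own risk); given K and F_rat it is equivalent to the crux on the irrational sector.
[cite: Shimura1977, Thm. 1] [cite: IwaniecSarnak2000, Thm. 17 / Cor. 13] [cite: DiamondTaylor1994, Thm. A]
[cite: BertoliniDarmon2005, §2 (n-admissible primes)] -/
theorem stub_irrationalShadowsFinite :
    ∀ (W : WeierstrassCurve ℚ) [W.IsElliptic] [W.IsGloballyMinimal] (p : ℕ) [Fact p.Prime],
      5 ≤ p → W.HasGoodReductionAtPrime p → ¬ (p : ℤ) ∣ W.frobeniusTrace p →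
      W.HasIrreducibleModPGaloisRep p →
      ∃ n : ℕ, Set.Finite {x : Σ M : ℕ, CuspForm (CongruenceSubgroup.Gamma0 (W.conductorNorm ℤ * M)) 2 |
        ∃ (_ : NeZero (W.conductorNorm ℤ * x.1)) (R : Subring ℂ) (φ : R →+* ZMod (p ^ n)) (hR : ∀ ℓ : ℕ, ℓ.Prime → ¬ ℓ ∣ W.conductorNorm ℤ * x.1 → heckeEigenvalue x.2 ℓ ∈ R), ¬ (∀ m : ℕ, ∃ a : ℤ, (qExpansion 1 ⇑(x.2)).coeff m = (a : ℂ)) ∧ Squarefree x.1 ∧ Nat.Coprime x.1 (p * W.conductorNorm ℤ) ∧ IsNewform0 x.2 ∧ (∃ m : ℕ, (qExpansion 1 ⇑(x.2)).coeff m ≠ ((W.LFunction m : ℤ) : ℂ)) ∧ cuspHeckeOperatorₗ (CongruenceSubgroup.Gamma0 (W.conductorNorm ℤ * x.1)) 2 (slToGLPos ModularGroup.S * diagGL ((W.conductorNorm ℤ * x.1 : ℕ) : ℚ) 1 (Nat.cast_pos.mpr (NeZero.pos (W.conductorNorm ℤ * x.1))) one_pos) x.2 = -(x.2) ∧ (∀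 (ℓ : ℕ) (hℓ : ℓ.Prime) (hℓL : ¬ ℓ ∣ W.conductorNorm ℤ * x.1), φ ⟨heckeEigenvalue x.2 ℓ, hR ℓ hℓ hℓL⟩ = ((W.frobeniusTrace ℓ : ℤ) : ZMod (p ^ n))) ∧ ∃ Λ : ℂ → ℂ, Differentiable ℂ Λ ∧ (∀ s : ℂ, 2 < s.re → Λ s = LSeries (fun m ↦ (qExpansion 1 ⇑(x.2)).coeff m) s) ∧ Λ 1 = 0} := by
  sorry

/-! ## Stub statements by name -/

namespace Statement

/-- Statement of `stub_modularity` (= `exists_isNewformOf`). -/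
abbrev stub_modularity : Prop := type_of% @Birth.stub_modularity
/-- Statement of `stub_depthRigidity` (landed, K). -/
abbrev stub_depthRigidity : Prop := type_of% @Birth.stub_depthRigidity
/-- Statement of `stub_eichlerShimura` (= `eichlerShimuraConstruction`). -/
abbrev stub_eichlerShimura : Prop := type_of% @Birth.stub_eichlerShimura
/-- Statement of `stub_deepCongruenceFinite` (= `DeepCongruenceFinite`). -/
abbrev stub_deepCongruenceFinite : Prop := type_of% @Birth.stub_deepCongruenceFinite
/-- Statement of `stub_rationalSectorFinite` (landed, F_rat). -/
abbrev stub_rationalSectorFinite : Prop := type_of% @Birth.stub_rationalSectorFinite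
/-- Statement of `stub_irrationalShadowsFinite` (open core, F_irr). -/
abbrev stub_irrationalShadowsFinite : Prop := type_of% @Birth.stub_irrationalShadowsFinite

end Statement

/-! ## The composition (sorry-free) -/

section Composition

/-- **`IsolationOfAccidentalZeros_of`** — the four OPEN stub statements imply the crux, BY NAME (v6 shape): the
LANDED transfer theorem T (`Summit.BirchSwinnertonDyer.BirchSwinnertonDyer.Theorems.stub_transfer`, p150301 — the
compactness cut, whose proof consumes the landed K = `Theorems.stub_depthRigidity` and F_rat =
`Theorems.stub_rationalSectorFinite`) applied to modularity M, the Eichler–Shimura fact ES, the deep-congruence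
finiteness fact DC and the irrational finiteness sector F_irr. K and F_rat stay in this file as the landed
theorems they now are (documentation of the line; not hypotheses). -/
theorem IsolationOfAccidentalZeros_of (hMod : Statement.stub_modularity) (hES : Statement.stub_eichlerShimura)
    (hDC : Statement.stub_deepCongruenceFinite) (hFi : Statement.stub_irrationalShadowsFinite) :
    IsolationOfAccidentalZeros :=
  Summit.BirchSwinnertonDyer.BirchSwinnertonDyer.Theorems.stub_transfer hMod hES hDC hFi

/-- Sanity link: the landed stubs K and F_rat are what the proof of T consumes (kept referenced so the
audit does not read them as orphans of this file). -/
theorem landed_stubs_used : Statement.stub_depthRigidity ∧ Statement.stub_rationalSectorFinite :=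
  ⟨stub_depthRigidity, stub_rationalSectorFinite⟩

/-- The crux along this line, MODULO the registered stubs (sorries live only in `stub_*`). -/
theorem IsolationOfAccidentalZeros_proof : IsolationOfAccidentalZeros :=
  IsolationOfAccidentalZeros_of stub_modularity stub_eichlerShimura stub_deepCongruenceFinite
    stub_irrationalShadowsFinite

end Composition

end Summit.BirchSwinnertonDyer.BirchSwinnertonDyer.Cruxes.IsolationOfAccidentalZeros.Birth
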